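import Summits.Ventures.HodgeRepro2.Defs

/-!
# Faces.lean — CM types on a Galois group, the inverse (reflex) type, balance is preserved

Seat p1 (gen 2) of the blind cell pub-hodge-repro2.  Printed sources transcribed:

* Deligne (notes by Milne), LNM 900 (1982), Ch. I Prop. 4.4: the Weil space of a product of CM
  abelian varieties with CM types `T_1, …, T_d` is of type `(d/2, d/2)` iff for every embedding
  `σ` exactly `d/2` of the `T_i` contain `σ` ("balance").  `IsWeilFace` (Defs.lean) is the case
  `d = 4`; here the same condition is written on an abstract group (`IsBalancedOn`).
* Shimura, *Abelian varieties with complex multiplication and modular functions*, Princeton 1998,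
  §8.4 Example (1): for `F` Galois over `ℚ`, regarding the embeddings as elements of
  `G = Gal(F/ℚ)`, the reflex type of `S = {φ_1, …, φ_n}` is `S* = {φ_1⁻¹, …, φ_n⁻¹}`; if `F` is
  abelian and `S` primitive, the reflex of `(F; S)` is `(F; S*)`.

The lemma asked for on the bus (lead, 2026-08-24T20:41Z; TIER3.md §5(i)): *the inverse of a balanced
tetrahedron of CM types is balanced* — `isBalancedOn_inv` (abstract group) and
`isWeilFace_inverseType` (embeddings of a Galois CM field).

Conventions.  A CM field `K` is Mathlib's `NumberField.IsCMField K`; its complex conjugation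
`IsCMField.complexConj K` acts on every embedding `φ : K →+* ℂ` by `φ (ρ x) = conj (φ x)`
(`IsCMField.complexEmbedding_complexConj`).  For `K/ℚ` Galois and a fixed embedding `τ₀`, the map
`σ ↦ τ₀ ∘ σ` is a bijection `Gal(K/ℚ) ≃ (K →+* ℂ)` intertwining left multiplication by `ρ` with
`NumberField.ComplexEmbedding.conjugate` (`galEmb`, `galEmb_galConj_mul`).  The inverse type
`inverseType τ₀ Φ` is `{τ₀ ∘ σ⁻¹ : τ₀ ∘ σ ∈ Φ}`; it depends on `τ₀` only up to translation by a
Galois element (a different base point `τ₀ ∘ h` replaces `σ⁻¹` by `h σ⁻¹ h`), which does not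
change the reflex field.  Nothing here asserts what the reflex type *is* for a non-primitive type;
only the combinatorics of inversion is proved.
-/

namespace Summit.Ventures.HodgeRepro2

open NumberField

/-! ## A. CM types and balanced 4-sets on a group with a central involution -/

section AbstractGroup

variable {G : Type*} [Group G]

/-- An abstract complex conjugation on a group `G`: a central element of order exactly 2.
For `G = Gal(K/ℚ)`, `K` a Galois CM field, this is `galConj K` (`isConjugation_galConj`). -/
structure IsConjugation (ρ : G) : Prop where
  /-- `ρ ≠ 1` -/
  ne_one : ρ ≠ 1
  /-- `ρ² = 1` -/
  mul_self : ρ * ρ = 1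
  /-- `ρ` is central -/
  central : ∀ g : G, ρ * g = g * ρ

/-- A CM type on `G` relative to the conjugation `ρ`: of every pair `{g, ρ g}` exactly one member
lies in `Φ` (the group-theoretic form of `IsCMType`). -/
def IsCMTypeOn (ρ : G) (Φ : Set G) : Prop :=
  ∀ g : G, Xor (g ∈ Φ) (ρ * g ∈ Φ)

/-- A balanced 4-set (rank-four face) of CM types on `G`: four CM types such that every `g ∈ G`
lies in exactly two of them — Deligne LNM 900 Prop. 4.4 with `d = 4`, `a_σ = b_σ = 2`
(the group-theoretic form of `IsWeilFace`). -/
def IsBalancedOn (ρ : G) (T : Fin 4 → Set G) : Prop :=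
  (∀ i, IsCMTypeOn ρ (T i)) ∧ ∀ g : G, Nat.card {i // g ∈ T i} = 2

/-- The conjugate CM type `ρ Φ = {g | ρ g ∈ Φ}` (the group-theoretic form of `conjCMType`). -/
def conjTypeOn (ρ : G) (Φ : Set G) : Set G :=
  {g | ρ * g ∈ Φ}

/-- A CM type on `G` is primitive if its stabiliser under left translation is trivial
(Shimura 1998 §8.4: for `F` abelian over `ℚ` this is the condition under which the reflex field
is `F` itself). -/
def IsPrimitiveOn (Φ : Set G) : Prop :=
  ∀ g : G, (∀ x, g * x ∈ Φ ↔ x ∈ Φ) → g = 1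

/-- `ρ⁻¹ = ρ`. -/
theorem IsConjugation.inv_eq {ρ : G} (h : IsConjugation ρ) : ρ⁻¹ = ρ :=
  inv_eq_of_mul_eq_one_right h.mul_self

/-- `(ρ g)⁻¹ = ρ g⁻¹` (ρ central, `ρ⁻¹ = ρ`). -/
theorem IsConjugation.mul_inv_comm {ρ : G} (h : IsConjugation ρ) (g : G) :
    (ρ * g)⁻¹ = ρ * g⁻¹ := by
  rw [mul_inv_rev, h.inv_eq, h.central]

/-- `(ρ g)⁻¹ = g⁻¹ ρ`. -/
theorem IsConjugation.inv_mul_eq {ρ : G} (h : IsConjugation ρ) (g : G) :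
    (ρ * g)⁻¹ = g⁻¹ * ρ := by
  rw [mul_inv_rev, h.inv_eq]

/-- `ρ (ρ g) = g`. -/
theorem IsConjugation.mul_mul_cancel {ρ : G} (h : IsConjugation ρ) (g : G) :
    ρ * (ρ * g) = g := by
  rw [← mul_assoc, h.mul_self, one_mul]

/-- The inverse of a CM type is a CM type (`ρ` central and of order 2). -/
theorem isCMTypeOn_inv {ρ : G} (hρ : IsConjugation ρ) {Φ : Set G} (h : IsCMTypeOn ρ Φ) :
    IsCMTypeOn ρ Φ⁻¹ := by
  intro g
  rw [Set.mem_inv, Set.mem_inv, hρ.mul_inv_comm]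
  exact h g⁻¹

/-- The conjugate of a CM type is a CM type. -/
theorem isCMTypeOn_conj {ρ : G} (hρ : IsConjugation ρ) {Φ : Set G} (h : IsCMTypeOn ρ Φ) :
    IsCMTypeOn ρ (conjTypeOn ρ Φ) := by
  intro g
  simp only [conjTypeOn, Set.mem_setOf_eq, hρ.mul_mul_cancel]
  rw [xor_comm]
  exact h g

/-- Inversion commutes with conjugation: `(ρΦ)⁻¹ = ρ(Φ⁻¹)`. -/
theorem conjTypeOn_inv {ρ : G} (hρ : IsConjugation ρ) (Φ : Set G) :
    (conjTypeOn ρ Φ)⁻¹ = conjTypeOn ρ Φ⁻¹ := by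
  ext g
  simp only [conjTypeOn, Set.mem_inv, Set.mem_setOf_eq, hρ.mul_inv_comm]

/-- **The inverse of a balanced 4-set is balanced** (lead's request, TIER3 §5(i)): if every `g`
lies in exactly two of the `T i`, then every `g` lies in exactly two of the `(T i)⁻¹`. -/
theorem isBalancedOn_inv {ρ : G} (hρ : IsConjugation ρ) {T : Fin 4 → Set G}
    (h : IsBalancedOn ρ T) : IsBalancedOn ρ (fun i => (T i)⁻¹) := by
  refine ⟨fun i => isCMTypeOn_inv hρ (h.1 i), fun g => ?_⟩
  simp only [Set.mem_inv]
  exact h.2 g⁻¹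

/-- Conjugating every member of a balanced 4-set gives a balanced 4-set. -/
theorem isBalancedOn_conj {ρ : G} (hρ : IsConjugation ρ) {T : Fin 4 → Set G}
    (h : IsBalancedOn ρ T) : IsBalancedOn ρ (fun i => conjTypeOn ρ (T i)) := by
  refine ⟨fun i => isCMTypeOn_conj hρ (h.1 i), fun g => ?_⟩
  simp only [conjTypeOn, Set.mem_setOf_eq]
  exact h.2 (ρ * g)

/-- In a balanced 4-set, `g` and `ρ g` together account for all four members: the number of
members containing `ρ g` is also 2 (Deligne's `b_σ = d − a_σ`). -/
theorem IsBalancedOn.card_conj {ρ : G} {T : Fin 4 → Set G} (h : IsBalancedOn ρ T) (g : G) :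
    Nat.card {i // ρ * g ∈ T i} = 2 :=
  h.2 (ρ * g)

/-- Translating a primitive CM type by a group element and then inverting: the inverse of a
primitive type is primitive when `G` is commutative (left and right stabilisers coincide). -/
theorem isPrimitiveOn_inv_of_comm {Φ : Set G} (hcomm : ∀ a b : G, a * b = b * a)
    (h : IsPrimitiveOn Φ) : IsPrimitiveOn Φ⁻¹ := by
  intro g hg
  have : ∀ x, g⁻¹ * x ∈ Φ ↔ x ∈ Φ := by
    intro x
    have hx := hg x⁻¹
    rw [Set.mem_inv, Set.mem_inv, inv_inv, mul_inv_rev, inv_inv, hcomm] at hx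
    exact hx
  have hg1 := h g⁻¹ this
  rwa [inv_eq_one] at hg1

end AbstractGroup

/-! ## B. Transport to the embeddings of a Galois CM field -/

section Transport

variable {K : Type*} [Field K]

/-- Transport of the CM-type condition along a conjugation-equivariant bijection
`e : G ≃ (K →+* ℂ)` (`e (ρ g) = conjugate (e g)`). -/
theorem isCMType_image_iff {G : Type*} [Group G] {ρ : G} (e : G ≃ (K →+* ℂ))
    (he : ∀ g, e (ρ * g) = ComplexEmbedding.conjugate (e g)) (Φ : Set G) :
    IsCMType K (e '' Φ) ↔ IsCMTypeOn ρ Φ := by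
  have hmem : ∀ (g : G) (S : Set G), e g ∈ e '' S ↔ g ∈ S := fun g S =>
    ⟨fun ⟨x, hx, hxg⟩ => e.injective hxg ▸ hx, fun hg => ⟨g, hg, rfl⟩⟩
  constructor
  · intro h g
    have := h (e g)
    rwa [← he, hmem, hmem] at this
  · intro h φ
    obtain ⟨g, rfl⟩ := e.surjective φ
    rw [← he, hmem, hmem]
    exact h g

/-- Transport of balance along a conjugation-equivariant bijection. -/
theorem isWeilFace_image_iff {G : Type*} [Group G] {ρ : G} (e : G ≃ (K →+* ℂ))
    (he : ∀ g, e (ρ * g) = ComplexEmbedding.conjugate (e g)) (T : Fin 4 → Set G) :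
    IsWeilFace K (fun i => e '' T i) ↔ IsBalancedOn ρ T := by
  have hmem : ∀ (g : G) (S : Set G), e g ∈ e '' S ↔ g ∈ S := fun g S =>
    ⟨fun ⟨x, hx, hxg⟩ => e.injective hxg ▸ hx, fun hg => ⟨g, hg, rfl⟩⟩
  have hcard : ∀ g : G, Nat.card {i // e g ∈ e '' T i} = Nat.card {i // g ∈ T i} := fun g =>
    Nat.card_congr (Equiv.subtypeEquivRight fun i => hmem g (T i))
  constructor
  · rintro ⟨h1, h2⟩
    refine ⟨fun i => (isCMType_image_iff e he (T i)).mp (h1 i), fun g => ?_⟩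
    rw [← hcard]
    exact h2 (e g)
  · rintro ⟨h1, h2⟩
    refine ⟨fun i => (isCMType_image_iff e he (T i)).mpr (h1 i), fun φ => ?_⟩
    obtain ⟨g, rfl⟩ := e.surjective φ
    rw [hcard]
    exact h2 g

end Transport

section GaloisEmbeddings

variable (K : Type*) [Field K] [NumberField K]

/-- `σ ↦ τ₀ ∘ σ` is injective (`τ₀` is injective). -/
theorem galEmb_injective (τ₀ : K →+* ℂ) :
    Function.Injective (fun σ : K ≃ₐ[ℚ] K => τ₀.comp (σ : K →+* K)) := by
  intro σ σ' h
  ext x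
  apply τ₀.injective
  exact RingHom.congr_fun h x

variable [IsGalois ℚ K]

/-- For `K/ℚ` Galois every complex embedding is `τ₀ ∘ σ` for some `σ ∈ Gal(K/ℚ)`. -/
theorem galEmb_surjective (τ₀ : K →+* ℂ) :
    Function.Surjective (fun σ : K ≃ₐ[ℚ] K => τ₀.comp (σ : K →+* K)) := by
  intro ψ
  obtain ⟨σ, hσ⟩ :=
    ComplexEmbedding.exists_comp_symm_eq_of_comp_eq (k := ℚ) τ₀ ψ (Subsingleton.elim _ _)
  exact ⟨σ.symm, hσ⟩

/-- The bijection `Gal(K/ℚ) ≃ (K →+* ℂ)`, `σ ↦ τ₀ ∘ σ`, attached to a base embedding `τ₀`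
(Shimura 1998 §8.4: "we consider the `φ_i` as elements of `G`"). -/
noncomputable def galEmb (τ₀ : K →+* ℂ) : (K ≃ₐ[ℚ] K) ≃ (K →+* ℂ) :=
  Equiv.ofBijective _ ⟨galEmb_injective K τ₀, galEmb_surjective K τ₀⟩

/-- `galEmb τ₀ σ = τ₀ ∘ σ`. -/
@[simp] theorem galEmb_apply (τ₀ : K →+* ℂ) (σ : K ≃ₐ[ℚ] K) :
    galEmb K τ₀ σ = τ₀.comp (σ : K →+* K) := rfl

/-- The inverse type of a set of embeddings, relative to the base point `τ₀`:
`inverseType τ₀ Φ = {τ₀ ∘ σ⁻¹ | τ₀ ∘ σ ∈ Φ}` — Shimura 1998 §8.4 Example (1), `S* = {φ_i⁻¹}`;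
for `K` abelian over `ℚ` and `Φ` primitive this is the reflex type of `(K, Φ)`. -/
def inverseType (τ₀ : K →+* ℂ) (Φ : Set (K →+* ℂ)) : Set (K →+* ℂ) :=
  galEmb K τ₀ '' ((galEmb K τ₀) ⁻¹' Φ)⁻¹

/-- `τ₀ ∘ σ ∈ Φ* ↔ τ₀ ∘ σ⁻¹ ∈ Φ`. -/
theorem mem_inverseType_iff (τ₀ : K →+* ℂ) (Φ : Set (K →+* ℂ)) (σ : K ≃ₐ[ℚ] K) :
    galEmb K τ₀ σ ∈ inverseType K τ₀ Φ ↔ galEmb K τ₀ σ⁻¹ ∈ Φ := by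
  unfold inverseType
  constructor
  · rintro ⟨g, hg, hgσ⟩
    rw [(galEmb K τ₀).injective hgσ] at hg
    simpa [Set.mem_inv, Set.mem_preimage] using hg
  · intro h
    exact ⟨σ, by simpa [Set.mem_inv, Set.mem_preimage] using h, rfl⟩

/-- `inverseType` is an involution. -/
theorem inverseType_inverseType (τ₀ : K →+* ℂ) (Φ : Set (K →+* ℂ)) :
    inverseType K τ₀ (inverseType K τ₀ Φ) = Φ := by
  ext φ
  obtain ⟨σ, rfl⟩ := (galEmb K τ₀).surjective φ
  rw [mem_inverseType_iff, mem_inverseType_iff, inv_inv]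

end GaloisEmbeddings

section GaloisCM

variable (K : Type*) [Field K] [NumberField K] [IsCMField K]

/-- Complex conjugation of the CM field `K` as an element of `Gal(K/ℚ)` (Mathlib's
`IsCMField.complexConj K` is a `K⁺`-algebra automorphism; every ring automorphism is `ℚ`-linear). -/
noncomputable def galConj : K ≃ₐ[ℚ] K :=
  AlgEquiv.ofRingEquiv (f := (IsCMField.complexConj K).toRingEquiv)
    (fun q => by simp [eq_ratCast])

/-- `galConj K` acts as Mathlib's `complexConj`. -/
@[simp] theorem galConj_apply (x : K) : galConj K x = IsCMField.complexConj K x := rfl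

/-- Every complex embedding intertwines `galConj K` with complex conjugation. -/
theorem embedding_galConj (φ : K →+* ℂ) (x : K) :
    φ (galConj K x) = (starRingEnd ℂ) (φ x) :=
  IsCMField.complexEmbedding_complexConj K φ x

/-- `galConj K` is central in `Gal(K/ℚ)`: for any `σ` the embedding `φ ∘ σ` also intertwines
`galConj` with `conj`, and `φ` is injective. -/
theorem galConj_mul_comm (σ : K ≃ₐ[ℚ] K) : galConj K * σ = σ * galConj K := by
  ext x
  rw [AlgEquiv.mul_apply, AlgEquiv.mul_apply]
  let φ : K →+* ℂ := Classical.choice (inferInstance : Nonempty (K →+* ℂ))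
  apply φ.injective
  have h1 : φ (σ (galConj K x)) = (starRingEnd ℂ) (φ (σ x)) :=
    embedding_galConj K (φ.comp (σ : K →+* K)) x
  rw [embedding_galConj K φ (σ x), h1]

/-- Complex conjugation is not the identity of `K`. -/
theorem galConj_ne_one : galConj K ≠ 1 := by
  intro h
  apply IsCMField.complexConj_ne_one K
  ext x
  have := congrArg (fun e : K ≃ₐ[ℚ] K => e x) h
  simpa using this

/-- Complex conjugation is an involution. -/
theorem galConj_mul_self : galConj K * galConj K = 1 := by
  ext x
  simp [AlgEquiv.mul_apply]

/-- Complex conjugation is an abstract conjugation (central involution) of `Gal(K/ℚ)`. -/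
theorem isConjugation_galConj : IsConjugation (galConj K) :=
  ⟨galConj_ne_one K, galConj_mul_self K, galConj_mul_comm K⟩

variable [IsGalois ℚ K]

/-- `galEmb` intertwines left multiplication by `galConj K` with complex conjugation of
embeddings. -/
theorem galEmb_galConj_mul (τ₀ : K →+* ℂ) (σ : K ≃ₐ[ℚ] K) :
    galEmb K τ₀ (galConj K * σ) = ComplexEmbedding.conjugate (galEmb K τ₀ σ) := by
  ext x
  change τ₀ ((galConj K * σ) x) = (starRingEnd ℂ) (τ₀ (σ x))
  rw [AlgEquiv.mul_apply]
  exact embedding_galConj K τ₀ (σ x)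

/-- Membership in a set of embeddings, read on the Galois group. -/
theorem isCMType_iff_isCMTypeOn (τ₀ : K →+* ℂ) (Φ : Set (K →+* ℂ)) :
    IsCMType K Φ ↔ IsCMTypeOn (galConj K) ((galEmb K τ₀) ⁻¹' Φ) := by
  conv_lhs => rw [← (galEmb K τ₀).image_preimage Φ]
  exact isCMType_image_iff (galEmb K τ₀) (galEmb_galConj_mul K τ₀) _

/-- A rank-four face of embeddings is a balanced 4-set on `Gal(K/ℚ)` (read through `galEmb τ₀`). -/
theorem isWeilFace_iff_isBalancedOn (τ₀ : K →+* ℂ) (T : Fin 4 → Set (K →+* ℂ)) :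
    IsWeilFace K T ↔ IsBalancedOn (galConj K) (fun i => (galEmb K τ₀) ⁻¹' (T i)) := by
  have : T = fun i => galEmb K τ₀ '' ((galEmb K τ₀) ⁻¹' (T i)) := by
    funext i
    rw [(galEmb K τ₀).image_preimage]
  conv_lhs => rw [this]
  exact isWeilFace_image_iff (galEmb K τ₀) (galEmb_galConj_mul K τ₀) _

/-- The inverse type of a CM type is a CM type. -/
theorem isCMType_inverseType (τ₀ : K →+* ℂ) {Φ : Set (K →+* ℂ)} (h : IsCMType K Φ) :
    IsCMType K (inverseType K τ₀ Φ) := by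
  rw [isCMType_iff_isCMTypeOn K τ₀] at h
  exact (isCMType_image_iff (galEmb K τ₀) (galEmb_galConj_mul K τ₀) _).mpr
    (isCMTypeOn_inv (isConjugation_galConj K) h)

/-- **The inverse of a balanced tetrahedron of CM types is balanced** (the lead's requested lemma,
TIER3.md §5(i): "inversion preserves balance"), for the embeddings of a Galois CM field. -/
theorem isWeilFace_inverseType (τ₀ : K →+* ℂ) {T : Fin 4 → Set (K →+* ℂ)}
    (h : IsWeilFace K T) : IsWeilFace K (fun i => inverseType K τ₀ (T i)) := by
  rw [isWeilFace_iff_isBalancedOn K τ₀] at h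
  exact (isWeilFace_image_iff (galEmb K τ₀) (galEmb_galConj_mul K τ₀) _).mpr
    (isBalancedOn_inv (isConjugation_galConj K) h)

/-- Inversion commutes with conjugation of types: `(Φ̄)* = (Φ*)‾`. -/
theorem inverseType_conjCMType (τ₀ : K →+* ℂ) (Φ : Set (K →+* ℂ)) :
    inverseType K τ₀ (conjCMType K Φ) = conjCMType K (inverseType K τ₀ Φ) := by
  ext φ
  obtain ⟨σ, rfl⟩ := (galEmb K τ₀).surjective φ
  have hc : ∀ g : K ≃ₐ[ℚ] K, ComplexEmbedding.conjugate (galEmb K τ₀ g) =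
      galEmb K τ₀ (galConj K * g) := fun g => (galEmb_galConj_mul K τ₀ g).symm
  simp only [conjCMType, Set.mem_setOf_eq, hc, mem_inverseType_iff,
    (isConjugation_galConj K).mul_inv_comm]

end GaloisCM

end Summit.Ventures.HodgeRepro2
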